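import Mathlib.Data.Nat.Choose.Sum
import Summits.Ventures.PercRepro.RankLevelSetTightLayer
import Summits.Ventures.PercRepro.RankLevelSetAvgArith

/-!
# PercRepro — PART 1 OF THE AVERAGED CHARGING: the independent subsets of a member of `U` pay the uniform demand
(night-1, gen 9 session 4; dossier §19.12 (c))

On the tight layer the members of `U(p,q)` are the independent `p`-sets with independent complement (`UF`).  Give every
independent set `T` with `q + 1 ≤ |T| ≤ p − 1` the weight `w_{|T|}` (`weightK`) and split it equally among the members
`s ⊇ T` of `UF`.  Since `T` lies in at most `C(n−|T|, p−|T|)` members (`card_filter_subset_le_choose`) and a member `s`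
has `C(p,u)` subsets of size `u`, every member receives at least `Σ_u w_u·C(p,u)/C(n−u,p−u) = n·Φ(p,q) − p·Φ(p−1,q)`
(`indep_charge_ge`, with `sum_weight_ratio_eq`).  Equality is the uniform case.

Axioms: standard.
-/

namespace PercRepro

open Finset

variable {α : Type} (M : Matroid α) [M.Finite]

/-- The members of `U(p,q)` on the tight layer, as finsets: independent `p`-sets with independent complement. -/
noncomputable def UF (p : ℕ) : Finset (Finset α) := by
  classical
  exact (indepSets M p).filter (fun s => M.Indep (M.E \ (s : Set α)))

open scoped Classical in
/-- Membership in `UF`. -/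
lemma mem_UF {p : ℕ} {s : Finset α} :
    s ∈ UF M p ↔ (s : Set α) ⊆ M.E ∧ s.card = p ∧ M.Indep (s : Set α) ∧ M.Indep (M.E \ (s : Set α)) := by
  unfold UF
  rw [Finset.mem_filter, mem_indepSets M, Set.Finite.subset_toFinset]
  tauto

open scoped Classical in
/-- A set `T ⊆ E` of size `u ≤ p` lies in at most `C(n − u, p − u)` members of `UF` (`n = |E|`). -/
lemma card_filter_subset_le_choose {p : ℕ} (T : Finset α) (hT : (T : Set α) ⊆ M.E) :
    ((UF M p).filter (fun s => T ⊆ s)).card ≤ (M.E.ncard - T.card).choose (p - T.card) := by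
  have hEfin : M.E.Finite := M.set_finite M.E
  set E' : Finset α := hEfin.toFinset with hE'
  have hTE' : T ⊆ E' := by
    intro x hx
    rw [hE', Set.Finite.mem_toFinset]
    exact hT hx
  have hcardE' : E'.card = M.E.ncard := by
    rw [hE', Set.ncard_eq_toFinset_card _ hEfin]
  -- inject `s ↦ s \ T` into the `(p − u)`-subsets of `E' \ T`
  have hinj : Set.InjOn (fun s : Finset α => s \ T) ↑((UF M p).filter (fun s => T ⊆ s)) := by
    intro s hs s' hs' h
    simp only [Finset.coe_filter, Set.mem_setOf_eq] at hs hs'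
    simp only at h
    calc s = (s \ T) ∪ T := (Finset.sdiff_union_of_subset hs.2).symm
      _ = (s' \ T) ∪ T := by rw [h]
      _ = s' := Finset.sdiff_union_of_subset hs'.2
  have hmaps : ∀ s ∈ (UF M p).filter (fun s => T ⊆ s), s \ T ∈ (E' \ T).powersetCard (p - T.card) := by
    intro s hs
    rw [Finset.mem_filter, mem_UF] at hs
    obtain ⟨⟨hsE, hscard, -, -⟩, hTs⟩ := hs
    rw [Finset.mem_powersetCard]
    refine ⟨?_, ?_⟩
    · intro x hx
      rw [Finset.mem_sdiff] at hx ⊢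
      refine ⟨?_, hx.2⟩
      rw [hE', Set.Finite.mem_toFinset]
      exact hsE hx.1
    · rw [Finset.card_sdiff_of_subset hTs, hscard]
  calc ((UF M p).filter (fun s => T ⊆ s)).card
      = (((UF M p).filter (fun s => T ⊆ s)).image (fun s => s \ T)).card :=
        (Finset.card_image_of_injOn hinj).symm
    _ ≤ ((E' \ T).powersetCard (p - T.card)).card := by
        apply Finset.card_le_card
        intro y hy
        rw [Finset.mem_image] at hy
        obtain ⟨s, hs, rfl⟩ := hy
        exact hmaps s hs
    _ = (M.E.ncard - T.card).choose (p - T.card) := by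
        rw [Finset.card_powersetCard, Finset.card_sdiff_of_subset hTE', hcardE']

open scoped Classical in
/-- A member `s` of `UF` is counted at least once for each of its subsets. -/
lemma one_le_card_filter_subset {p : ℕ} {s : Finset α} (hs : s ∈ UF M p) {T : Finset α} (hT : T ⊆ s) :
    1 ≤ ((UF M p).filter (fun s' => T ⊆ s')).card :=
  Finset.card_pos.2 ⟨s, Finset.mem_filter.2 ⟨hs, hT⟩⟩

/-- `weightK` is non-negative. -/
lemma weightK_nonneg (p q u : ℕ) : 0 ≤ weightK p q u := by
  unfold weightK
  split_ifs <;> positivity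

open scoped Classical in
/-- **PART 1 OF THE AVERAGED CHARGING** (tight layer `|E| = p + q`, `1 ≤ q`, `q + 2 ≤ p`): every member `s` of `U(p,q)`
receives at least `n·Φ(p,q) − p·Φ(p−1,q)` from its subsets `T` of size in `[q+1, p−1]`, each `T` giving `w_{|T|}`
split equally among the members containing it. -/
theorem indep_charge_ge {p q : ℕ} (hq : 1 ≤ q) (hpq : q + 2 ≤ p) (hE : M.E.ncard = p + q)
    {s : Finset α} (hs : s ∈ UF M p) :
    ((p + q : ℕ) : ℚ) * phiK p q - (p : ℚ) * phiK (p - 1) q ≤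
      ∑ T ∈ s.powerset.filter (fun T => q + 1 ≤ T.card ∧ T.card ≤ p - 1),
        weightK p q T.card / (((UF M p).filter (fun s' => T ⊆ s')).card : ℚ) := by
  have hsE : (s : Set α) ⊆ M.E := (mem_UF M |>.1 hs).1
  have hscard : s.card = p := (mem_UF M |>.1 hs).2.1
  -- the pointwise bound: `w/#{s' ⊇ T} ≥ w/C(n−u,p−u) = w·ratioK/C(p,u)`
  have hpt : ∀ T ∈ s.powerset.filter (fun T => q + 1 ≤ T.card ∧ T.card ≤ p - 1),
      weightK p q T.card * ratioK p q T.card / ((p.choose T.card : ℕ) : ℚ) ≤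
        weightK p q T.card / (((UF M p).filter (fun s' => T ⊆ s')).card : ℚ) := by
    intro T hT
    rw [Finset.mem_filter, Finset.mem_powerset] at hT
    obtain ⟨hTs, hq1, hp1⟩ := hT
    have hTE : (T : Set α) ⊆ M.E := (Finset.coe_subset.2 hTs).trans hsE
    have hup : T.card ≤ p := by omega
    have hcnt := card_filter_subset_le_choose M (p := p) T hTE
    have hcnt1 := one_le_card_filter_subset M hs hTs
    have hch : (0 : ℚ) < ((p.choose T.card : ℕ) : ℚ) := by exact_mod_cast Nat.choose_pos hup
    have hden : (0 : ℚ) < ((((p + q : ℕ) - T.card).choose (p - T.card) : ℕ) : ℚ) := by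
      exact_mod_cast Nat.choose_pos (by omega)
    have hcnt' : (0 : ℚ) < (((UF M p).filter (fun s' => T ⊆ s')).card : ℚ) := by exact_mod_cast hcnt1
    have hcntq : (((UF M p).filter (fun s' => T ⊆ s')).card : ℚ) ≤
        ((((p + q : ℕ) - T.card).choose (p - T.card) : ℕ) : ℚ) := by
      rw [← hE]; exact_mod_cast hcnt
    have hkey : weightK p q T.card * ratioK p q T.card / ((p.choose T.card : ℕ) : ℚ) =
        weightK p q T.card / ((((p + q : ℕ) - T.card).choose (p - T.card) : ℕ) : ℚ) := by
      unfold ratioK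
      have h1 := hch.ne'
      have h2 := hden.ne'
      field_simp
    rw [hkey]
    exact div_le_div_of_nonneg_left (weightK_nonneg p q T.card) hcnt' hcntq
  refine le_trans ?_ (Finset.sum_le_sum hpt)
  -- the left side is a sum over the powerset of a function of the card
  have hsum : ∑ T ∈ s.powerset.filter (fun T => q + 1 ≤ T.card ∧ T.card ≤ p - 1),
      weightK p q T.card * ratioK p q T.card / ((p.choose T.card : ℕ) : ℚ) =
      ∑ T ∈ s.powerset, (if q + 1 ≤ T.card ∧ T.card ≤ p - 1 then
        weightK p q T.card * ratioK p q T.card / ((p.choose T.card : ℕ) : ℚ) else 0) := by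
    rw [Finset.sum_filter]
  rw [hsum, Finset.sum_powerset_apply_card
    (fun u => if q + 1 ≤ u ∧ u ≤ p - 1 then weightK p q u * ratioK p q u / ((p.choose u : ℕ) : ℚ) else 0),
    hscard]
  -- `Σ_{u ∈ range (p+1)} C(p,u) • [q+1 ≤ u ≤ p−1]·w·r/C(p,u) = Σ_{u ∈ Ioo q p} w·r`
  have hre : ∑ u ∈ Finset.range (p + 1), (p.choose u) •
      (if q + 1 ≤ u ∧ u ≤ p - 1 then weightK p q u * ratioK p q u / ((p.choose u : ℕ) : ℚ) else 0) =
      ∑ u ∈ Finset.Ioo q p, weightK p q u * ratioK p q u := by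
    rw [← Finset.sum_filter_add_sum_filter_not (Finset.range (p + 1)) (fun u => q + 1 ≤ u ∧ u ≤ p - 1)]
    have hI : (Finset.range (p + 1)).filter (fun u => q + 1 ≤ u ∧ u ≤ p - 1) = Finset.Ioo q p := by
      ext u
      simp only [Finset.mem_filter, Finset.mem_range, Finset.mem_Ioo]
      omega
    rw [hI]
    have hz : ∑ u ∈ (Finset.range (p + 1)).filter (fun u => ¬ (q + 1 ≤ u ∧ u ≤ p - 1)), (p.choose u) •
        (if q + 1 ≤ u ∧ u ≤ p - 1 then weightK p q u * ratioK p q u / ((p.choose u : ℕ) : ℚ) else 0) = 0 := by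
      refine Finset.sum_eq_zero (fun u hu => ?_)
      rw [Finset.mem_filter] at hu
      rw [if_neg hu.2, smul_zero]
    rw [hz, add_zero]
    refine Finset.sum_congr rfl (fun u hu => ?_)
    rw [Finset.mem_Ioo] at hu
    rw [if_pos ⟨by omega, by omega⟩, nsmul_eq_mul]
    have hch : (0 : ℚ) < ((p.choose u : ℕ) : ℚ) := by exact_mod_cast Nat.choose_pos (by omega)
    field_simp
  rw [hre, sum_weight_ratio_eq hq hpq]

end PercRepro
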